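import Summits.CriticalPhenomena.PercolationContinuityZ3.Theorems.Transplant.FKConnectivityAllQGluing
import Summits.CriticalPhenomena.PercolationContinuityZ3.Theorems.Transplant.FKConnectivityAllQUniformLevelGluing
import HarnessLib

/-!
# The SLACK FOUR-POINT inequality (SFP): the weakest product inequality that gives Kozma–Nitzan's additive gluing for two relay
# points — statement, `FourPoint ⇒ SFP ⇒ AG₂` for ANY finite measure, the nodes `SlackFourPointCountPos` / `SlackFourPointFKPos` /
# `SlackFourPointBilevelPos`, and the reduction BILEVEL (Bernoulli percolation, level slices) ⇒ SFP under EVERY count weight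

Support file (`--supports stmt-CriticalPhenomena-4575`), FK sub-lane `prim-bschramm-fk-1` (gen 12) of the post-continuity programme;
builds on p205010 (kernel theorem, internal audit signed; external expert review pending).  Definitions (`glueDefect`,
`SlackFourPointUnder`, `SlackFourPointBilevelOn`, three `@[conjecture]` nodes — NOT asserted), no named facts, no sorries; standard axioms.
Nothing here bears on p205010 (its chain proves additive gluing for PRODUCT measure); this file is about which other measures inherit it.

THE POINT.  For a source `o`, target `b` and relays `a, c` write `F = ({o ↔ a} ∪ {o ↔ c}) ∖ {o ↔ b}` (the gluing defect, `glueDefect`),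
`x₆ = μ{oa|cb}`, `x₇ = μ{oc|ab}` (exact partition patterns on the four points) and `g₃ = μ({c ↮ b} ∖ F)`, `g₄ = μ({a ↮ b} ∖ F)`.
Kozma–Nitzan's additive gluing for the relay pair FAILS for relay `a` iff `μ(F) > μ(a ↮ b)` iff `x₇ > g₄` (because `F ∩ {a ↔ b} = {oc|ab}`),
and for relay `c` iff `x₆ > g₃`.  Hence the product inequality

**(SFP) `SlackFourPointUnder μ o a c b`:  `x₆ · x₇ ≤ g₃ · g₄`**

implies additive gluing for `{a, c}` under ANY finite measure (`additiveGluingUnder_pair_of_slackFourPoint`), and it is the WEAKEST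
inequality of product form doing so; Kozma–Nitzan's four-point inequality `x₆x₇ ≤ x₃x₄` (`FourPointUnder`, `x₃ = μ{oab|c} ≤ g₃`,
`x₄ = μ{ocb|a} ≤ g₄`) implies it (`slackFourPointUnder_of_fourPoint`).  WHY IT MATTERS: under cluster-count reweightings
`μ_h ∝ P_w·h(k)` the four-point inequality is FK-RIGID (it holds on all finite graphs only for geometric `h`, fk-1 g11
`geometric_of_fourPoint_all`; it fails on the 6-cycle for `h = k!`), whereas additive gluing has no census counterexample for ANY `h`
(`AdditiveGluingCountPos`, fk-1 g9–g11, ≈ 9·10⁶ placements).  EVIDENCE OF THIS SEAT (exact/float censuses, seat numerics/sfp2.py,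
spi.py, sfp_prime.py, sfp_exact.py; memo bschramm/FROM-fk-1-g12-SLACK-FOURPOINT.md): the slack four-point inequality holds
ENTRYWISE-BILEVEL (`SlackFourPointBilevelOn`: the symmetrised level-pair inequality for Bernoulli percolation, which sums to SFP under every
`h ≥ 0`) in every cell tested — 63,540 placements `(G, w, o, a, c, b)` on random weighted graphs with 4 ≤ n ≤ 8 vertices (n = 4: 2,400;
n = 5: 5,400; n = 6: 25,740 incl. all placements on the 6-cycle cells where `FourPoint_h` dies and the fk-1 g11 log-concave witness; n = 7:
24,000; n = 8: 6,000), > 1.4·10⁶ level-pair cells, 0 violations (12 graphs at n = 6 re-verified in exact rational arithmetic: 6,628 non-zero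
cells, 0 violations, 42 exact ties — all at a target of degree two adjacent to both relays, where the level-2 inequality is an identity),
while the plain four-point inequality fails entrywise in 2,447 of the same cells.  Two natural neighbours are FALSE: dropping the
`{o ↮ a, o ↮ c}` part of the slack (targets `{o ↔ b, c ↮ b} × {o ↔ b, a ↮ b}`) fails at n = 6 (54 / 7,200 placements entrywise, 212 value-level
instances incl. parity weights), and the three-relay product `∏_{a ∈ A} μ(F ∩ {a ↔ b}) ≤ ∏_{a ∈ A} μ({a ↮ b} ∖ F)` fails already for product
measure (n = 5, 25 / 800 placements).  The fibre × level-pair (coefficientwise) refinement of SFP is false as well (multigraph witnesses),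
so SFP is a statement about weighted sums, not an injection.

CONTENTS.  `glueDefect`, `SlackFourPointUnder`; `slack_glue_diff_le` (`μ(F) − μ(a ↮ b) ≤ x₇ − g₄`, sharpening `glue_diff_le`);
`slackFourPointUnder_of_fourPoint`; `additiveGluingUnder_pair_of_slackFourPoint`, `additiveGluingUnder_of_card_le_two_of_slackFourPoint`;
nodes `SlackFourPointCountPos` (SFP under every count weight), `SlackFourPointFKPos` (every `φ_{w,q}`, `q > 0`), `SlackFourPointBilevelPos`
(the level-pair form for Bernoulli percolation), with `slackFourPointFKPos_of_fourPointFKPos`, `slackFourPointFKPos_of_countPos`,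
`additiveGluingTwoFKPos_of_slackFourPointFKPos`, `additiveGluing_two_of_slackFourPointCountPos` (the `|A| ≤ 2` slice of
`AdditiveGluingCountPos`), `slackFourPointUnder_crMeasure_of_bilevel`, `slackFourPointCountPos_of_bilevelPos`.
[cite: KozmaNitzan2024, Conj. 1 (p. 3); Thm. 1, eq. (6) (pp. 7–8)] [cite: Grimmett2006, §1.4 eq. (1.20) (p. 15); §3.9 (pp. 63–65)]
-/

noncomputable section

namespace Summit.CriticalPhenomena.PercolationContinuityZ3.Theorems

namespace FK

open MeasureTheory Set Literature.Probability.LatticeModels Literature.Probability.Percolation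
open scoped Classical

variable {V : Type*}

/-! ### The gluing defect and the slack four-point inequality -/

/-- **The gluing defect** `F = ({o ↔ a} ∪ {o ↔ c}) ∖ {o ↔ b}`: the observer reaches a relay but not the target.
[cite: KozmaNitzan2024, proof of Thm. 1 (p. 7)] -/
def glueDefect (o a c b : V) : Set (BondConfig V) := (openConn o a ∪ openConn o c) \ openConn o b

/-- The gluing defect is symmetric in the two relays. [folklore] -/
theorem glueDefect_comm (o a c b : V) : (glueDefect o c a b : Set (BondConfig V)) = glueDefect o a c b := by
  unfold glueDefect; rw [Set.union_comm]

/-- **Slack four-point inequality under `μ`** (SFP): `μ{oa|cb}·μ{oc|ab} ≤ μ({c ↮ b} ∖ F)·μ({a ↮ b} ∖ F)`, `F` the gluing defect.  The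
weakest product-form inequality implying Kozma–Nitzan's additive gluing for the relay pair `{a, c}`; implied by `FourPointUnder`.
[cite: KozmaNitzan2024, Thm. 1, eq. (6) (pp. 7–8); Conj. 1 (p. 3)] -/
def SlackFourPointUnder (μ : Measure (BondConfig V)) (o a c b : V) : Prop :=
  μ.real (openConn o a ∩ openConn b c ∩ sepEv a c) * μ.real (openConn o c ∩ openConn b a ∩ sepEv a c) ≤
    μ.real ((openConn c b)ᶜ \ glueDefect o a c b) * μ.real ((openConn a b)ᶜ \ glueDefect o a c b)

section AnyMeasure

variable [Fintype V]

omit [Fintype V] in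
/-- `{oab|c} ⊆ {c ↮ b} ∖ F`. [cite: KozmaNitzan2024, proof of Thm. 1 (p. 7)] -/
theorem x3_subset_slack (o a c b : V) :
    openConn o a ∩ openConn b a ∩ (sepEv a c : Set (BondConfig V)) ⊆ (openConn c b)ᶜ \ glueDefect o a c b := by
  have h := x4_subset_compl o c a b
  rw [← sepEv_comm a c] at h
  unfold glueDefect
  rw [Set.union_comm]
  exact h

omit [Fintype V] in
/-- `{ocb|a} ⊆ {a ↮ b} ∖ F`. [cite: KozmaNitzan2024, proof of Thm. 1 (p. 7)] -/
theorem x4_subset_slack (o a c b : V) :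
    openConn o c ∩ openConn b c ∩ (sepEv a c : Set (BondConfig V)) ⊆ (openConn a b)ᶜ \ glueDefect o a c b :=
  x4_subset_compl o a c b

omit [Fintype V] in
/-- **Four-point ⇒ slack four-point** (any measure): `x₃ ≤ g₃` and `x₄ ≤ g₄`. [cite: KozmaNitzan2024, Thm. 1, eq. (6) (pp. 7–8)] -/
theorem slackFourPointUnder_of_fourPoint (μ : Measure (BondConfig V)) [IsFiniteMeasure μ] (o a c b : V)
    (h4 : FourPointUnder μ o a c b) : SlackFourPointUnder μ o a c b := by
  unfold SlackFourPointUnder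
  unfold FourPointUnder at h4
  refine h4.trans (mul_le_mul (measureReal_mono (x3_subset_slack o a c b)) (measureReal_mono (x4_subset_slack o a c b))
    measureReal_nonneg measureReal_nonneg)

/-- **Sharp half of the gluing bound**: `μ(F) − μ(a ↮ b) ≤ μ{oc|ab} − μ({a ↮ b} ∖ F)` (in fact an identity, since `F ∩ {a ↔ b} = {oc|ab}`).
[cite: KozmaNitzan2024, proof of Thm. 1 (pp. 7–8)] -/
theorem slack_glue_diff_le (μ : Measure (BondConfig V)) [IsFiniteMeasure μ] (o a c b : V) :
    μ.real (glueDefect o a c b) - μ.real (openConn a b)ᶜ ≤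
      μ.real (openConn o c ∩ openConn b a ∩ sepEv a c) - μ.real ((openConn a b)ᶜ \ glueDefect o a c b) := by
  set F : Set (BondConfig V) := glueDefect o a c b with hFdef
  have hmeas : MeasurableSet (openConn a b : Set (BondConfig V)) := measurableSet_bond _
  have hmeasF : MeasurableSet F := measurableSet_bond _
  have hsplit : μ.real F = μ.real (F ∩ openConn a b) + μ.real (F \ openConn a b) :=
    (measureReal_inter_add_sdiff (μ := μ) (s := F) hmeas).symm
  have hsplit' : μ.real (openConn a b)ᶜ = μ.real ((openConn a b)ᶜ ∩ F) + μ.real ((openConn a b)ᶜ \ F) :=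
    (measureReal_inter_add_sdiff (μ := μ) (s := (openConn a b)ᶜ) hmeasF).symm
  have h1 : μ.real (F ∩ openConn a b) ≤ μ.real (openConn o c ∩ openConn b a ∩ sepEv a c) :=
    measureReal_mono (glue_diff_inter_subset_x7 o a c b)
  have heq : (openConn a b)ᶜ ∩ F = F \ openConn a b := by
    rw [Set.sdiff_eq_compl_inter]
  rw [heq] at hsplit'
  linarith

/-- **Slack four-point ⇒ additive gluing for the relay pair `{a, c}`** (any probability measure on the bond configurations of a finite
vertex type).  Proof: `μ(o ↔ {a,c}) − μ(o ↔ b) ≤ μ(F)`; if `μ(F) > t ≥ μ(a ↮ b), μ(c ↮ b)` then `x₇ > g₄ ≥ 0` and `x₆ > g₃ ≥ 0`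
(`slack_glue_diff_le`), so `x₆x₇ > g₃g₄`, contradicting (SFP). [cite: KozmaNitzan2024, Conj. 1 (p. 3) and Thm. 1 (p. 7)] -/
theorem additiveGluingUnder_pair_of_slackFourPoint (μ : Measure (BondConfig V)) [IsProbabilityMeasure μ] (o a c b : V)
    (hS : SlackFourPointUnder μ o a c b) : AdditiveGluingUnder μ ({a, c} : Finset V) o b := by
  intro t ht hA
  have hpair : (⋃ x ∈ ({a, c} : Finset V), (openConn o x : Set (BondConfig V))) = openConn o a ∪ openConn o c := by
    ext ω; simp [Finset.mem_insert, Finset.mem_singleton]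
  rw [hpair]
  set F : Set (BondConfig V) := glueDefect o a c b with hFdef
  -- `μ(U) ≤ μ(o↔b) + μ(F)`
  have hU : μ.real (openConn o a ∪ openConn o c) ≤ μ.real (openConn o b) + μ.real F := by
    calc μ.real (openConn o a ∪ openConn o c) ≤ μ.real (openConn o b ∪ F) := measureReal_mono (fun ω hω => by
            by_cases h : ω ∈ openConn o b
            · exact Or.inl h
            · exact Or.inr ⟨hω, h⟩)
      _ ≤ μ.real (openConn o b) + μ.real F := measureReal_union_le _ _
  -- slacks
  have hta : μ.real (openConn a b)ᶜ ≤ t := by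
    have := hA a (by simp)
    rw [measureReal_compl (measurableSet_bond _), probReal_univ]; linarith
  have htc : μ.real (openConn c b)ᶜ ≤ t := by
    have := hA c (by simp)
    rw [measureReal_compl (measurableSet_bond _), probReal_univ]; linarith
  -- the two sharp half-bounds
  have ha := slack_glue_diff_le μ o a c b
  have hc := slack_glue_diff_le μ o c a b
  rw [glueDefect_comm, ← sepEv_comm a c] at hc
  unfold SlackFourPointUnder at hS
  set x₆ := μ.real (openConn o a ∩ openConn b c ∩ sepEv a c)
  set x₇ := μ.real (openConn o c ∩ openConn b a ∩ sepEv a c)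
  set g₃ := μ.real ((openConn c b)ᶜ \ glueDefect o a c b)
  set g₄ := μ.real ((openConn a b)ᶜ \ glueDefect o a c b)
  have hg₃ : 0 ≤ g₃ := measureReal_nonneg
  have hg₄ : 0 ≤ g₄ := measureReal_nonneg
  have key : μ.real F ≤ t := by
    by_contra hF
    push Not at hF
    have h7 : g₄ < x₇ := by linarith
    have h6 : g₃ < x₆ := by linarith
    have : g₃ * g₄ < x₆ * x₇ := by nlinarith
    linarith
  linarith

/-- **Slack four-point at every pair ⇒ additive gluing for every relay set with at most two points** (any probability measure).
[cite: KozmaNitzan2024, Conj. 1 (p. 3), Thm. 1 (p. 7)] -/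
theorem additiveGluingUnder_of_card_le_two_of_slackFourPoint (μ : Measure (BondConfig V)) [IsProbabilityMeasure μ] (o b : V)
    (hS : ∀ a c : V, SlackFourPointUnder μ o a c b) (A : Finset V) (hA : A.card ≤ 2) : AdditiveGluingUnder μ A o b := by
  rcases Nat.lt_or_ge A.card 1 with h0 | h1
  · have hA0 : A.card = 0 := by omega
    have : A = ∅ := Finset.card_eq_zero.mp hA0
    subst this; exact additiveGluingUnder_empty μ o b
  rcases Nat.lt_or_ge A.card 2 with h1' | h2
  · have hA1 : A.card = 1 := by omega
    obtain ⟨a, rfl⟩ := Finset.card_eq_one.mp hA1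
    exact additiveGluingUnder_singleton μ o a b
  · have hA2 : A.card = 2 := by omega
    obtain ⟨a, c, -, rfl⟩ := Finset.card_eq_two.mp hA2
    exact additiveGluingUnder_pair_of_slackFourPoint μ o a c b (hS a c)

end AnyMeasure

/-! ### The nodes -/

/-- **Slack four-point inequality under every cluster-count-reweighted product measure** `μ_h ∝ P_w·h(k)`, `h > 0`, on every finite
weighted graph and for all `o, a, c, b`.  CONJECTURE-SHAPED STATEMENT, NOT asserted.  Evidence (fk-1 g12, 2026-08-21): the stronger
level-pair form `SlackFourPointBilevelPos` has 0 violations in > 1.4·10⁶ level-pair cells (63,540 placements, n ≤ 8; module docstring), whereas the four-point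
inequality itself fails for every non-geometric `h` (`geometric_of_fourPoint_all`).  Gives additive gluing for `|A| ≤ 2` under every count
weight (`additiveGluing_two_of_slackFourPointCountPos`). [cite: KozmaNitzan2024, Conj. 1 (p. 3); Thm. 1 (p. 7)]
[cite: Grimmett2006, §1.4 eq. (1.20) (p. 15)] -/
@[conjecture] def SlackFourPointCountPos : Prop :=
  ∀ (n : ℕ) (w : Sym2 (Fin n) → unitInterval) (h : ℕ → ℝ), (∀ k, 0 < h k) →
    ∀ (o a c b : Fin n), SlackFourPointUnder (crMeasure w h) o a c b

/-- **Slack four-point inequality for every random-cluster measure `φ_{w,q}`, `q > 0`.**  CONJECTURE-SHAPED STATEMENT, NOT asserted;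
implied by `FourPointFKPos` and by `SlackFourPointCountPos` (`h = q^k`); a theorem for `q ≥ 1` via `fourPointFK_of_one_le`.
[cite: KozmaNitzan2024, Thm. 1 (p. 7)] [cite: Grimmett2006, §3.9 (pp. 63–65)] -/
@[conjecture] def SlackFourPointFKPos : Prop :=
  ∀ q : ℝ, 0 < q → ∀ (n : ℕ) (w : Sym2 (Fin n) → unitInterval) (o a c b : Fin n), SlackFourPointUnder (rcMeasureW w q ∅) o a c b

/-- `FourPointFKPos → SlackFourPointFKPos`. [cite: KozmaNitzan2024, Thm. 1 (p. 7)] -/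
theorem slackFourPointFKPos_of_fourPointFKPos (h : FourPointFKPos) : SlackFourPointFKPos := by
  intro q hq n w o a c b
  haveI := isProbabilityMeasure_rcMeasureW w hq (∅ : Set (Fin n))
  exact slackFourPointUnder_of_fourPoint _ o a c b (h q hq n w o a c b)

/-- `SlackFourPointCountPos → SlackFourPointFKPos` (take `h = q^k`). [cite: Grimmett2006, §1.4 eq. (1.20) (p. 15)] -/
theorem slackFourPointFKPos_of_countPos (h : SlackFourPointCountPos) : SlackFourPointFKPos := by
  intro q hq n w o a c b
  have key := h n w (fun k => q ^ k) (fun k => pow_pos hq k) o a c b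
  rw [crMeasure_pow_eq_rcMeasureW] at key
  exact key

/-- **`SlackFourPointFKPos → AdditiveGluingTwoFKPos`**: the slack four-point inequality for every `φ_{w,q}` gives Kozma–Nitzan's additive
gluing for relay sets of size `≤ 2`, every `q > 0`. [cite: KozmaNitzan2024, Conj. 1 (p. 3)] -/
theorem additiveGluingTwoFKPos_of_slackFourPointFKPos (h : SlackFourPointFKPos) : AdditiveGluingTwoFKPos := by
  intro q hq n w A o b hA
  haveI := isProbabilityMeasure_rcMeasureW w hq (∅ : Set (Fin n))
  exact additiveGluingUnder_of_card_le_two_of_slackFourPoint _ o b (fun a c => h q hq n w o a c b) A hA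

/-- **`SlackFourPointCountPos` gives the `|A| ≤ 2` slice of `AdditiveGluingCountPos`**: additive gluing for relay sets of size `≤ 2` under
every positive cluster-count reweighting. [cite: KozmaNitzan2024, Conj. 1 (p. 3)] [cite: Grimmett2006, §1.4 eq. (1.20) (p. 15)] -/
theorem additiveGluing_two_of_slackFourPointCountPos (hS : SlackFourPointCountPos) (n : ℕ) (w : Sym2 (Fin n) → unitInterval)
    (h : ℕ → ℝ) (hpos : ∀ k, 0 < h k) (A : Finset (Fin n)) (o b : Fin n) (hA : A.card ≤ 2) :
    AdditiveGluingUnder (crMeasure w h) A o b := by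
  haveI := isProbabilityMeasure_crMeasure w hpos
  exact additiveGluingUnder_of_card_le_two_of_slackFourPoint _ o b (fun a c => hS n w h hpos o a c b) A hA

/-! ### The level-pair (bilevel) form for Bernoulli percolation, and its summation to every count weight -/

section Bilevel

variable [Fintype V]

/-- **Bilevel slack four-point for Bernoulli percolation on the vertex type `V`**: for all weights `w`, all `o, a, c, b` and every pair of
levels `j, j'` (`L_j = {k = j}`), writing `X₆ = {oa|cb}`, `X₇ = {oc|ab}`, `G₃ = {c ↮ b} ∖ F`, `G₄ = {a ↮ b} ∖ F`:
`P(X₆ ∩ L_j)P(X₇ ∩ L_j') + P(X₆ ∩ L_j')P(X₇ ∩ L_j) ≤ P(G₃ ∩ L_j)P(G₄ ∩ L_j') + P(G₃ ∩ L_j')P(G₄ ∩ L_j)`.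
(The diagonal `j = j'` is the slack four-point inequality for the level-conditioned percolation measure `P_w(· | k = j)`.)
[cite: KozmaNitzan2024, Thm. 1 (p. 7)] [cite: Grimmett2006, §1.2 eq. (1.1) (p. 4)] -/
def SlackFourPointBilevelOn (V : Type*) [Fintype V] : Prop :=
  ∀ (w : Sym2 V → unitInterval) (o a c b : V) (j j' : ℕ),
    (prodBernoulli w).real (openConn o a ∩ openConn b c ∩ sepEv a c ∩ levelSet V j) *
        (prodBernoulli w).real (openConn o c ∩ openConn b a ∩ sepEv a c ∩ levelSet V j') +
      (prodBernoulli w).real (openConn o a ∩ openConn b c ∩ sepEv a c ∩ levelSet V j') *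
        (prodBernoulli w).real (openConn o c ∩ openConn b a ∩ sepEv a c ∩ levelSet V j) ≤
    (prodBernoulli w).real (((openConn c b)ᶜ \ glueDefect o a c b) ∩ levelSet V j) *
        (prodBernoulli w).real (((openConn a b)ᶜ \ glueDefect o a c b) ∩ levelSet V j') +
      (prodBernoulli w).real (((openConn c b)ᶜ \ glueDefect o a c b) ∩ levelSet V j') *
        (prodBernoulli w).real (((openConn a b)ᶜ \ glueDefect o a c b) ∩ levelSet V j)

/-- **Bilevel slack four-point on every finite weighted graph.**  CONJECTURE-SHAPED STATEMENT about Bernoulli percolation, NOT asserted.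
Evidence (fk-1 g12, float with exact re-verification, seat numerics/sfp2.py, sfp_exact.py): 0 violations in > 1.4·10⁶ level-pair cells
(63,540 placements on weighted graphs with 4–8 vertices); its coefficientwise (fibre × level-pair) refinement is FALSE.  Sums to `SlackFourPointCountPos`
(`slackFourPointCountPos_of_bilevelPos`). [cite: KozmaNitzan2024, Thm. 1 (p. 7)] [cite: Grimmett2006, §1.2 eq. (1.1) (p. 4)] -/
@[conjecture] def SlackFourPointBilevelPos : Prop := ∀ n : ℕ, SlackFourPointBilevelOn (Fin n)

/-- Symmetrised double sums: if `a_j b_{j'} + a_{j'} b_j ≤ c_j d_{j'} + c_{j'} d_j` for all `j, j'` then `(Σ a)(Σ b) ≤ (Σ c)(Σ d)`. [folklore] -/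
theorem sum_mul_sum_le_of_symm {R : Finset ℕ} {a b c d : ℕ → ℝ}
    (H : ∀ j ∈ R, ∀ j' ∈ R, a j * b j' + a j' * b j ≤ c j * d j' + c j' * d j) :
    (∑ j ∈ R, a j) * (∑ j ∈ R, b j) ≤ (∑ j ∈ R, c j) * (∑ j ∈ R, d j) := by
  have key : ∑ j ∈ R, ∑ j' ∈ R, (a j * b j' + a j' * b j) ≤ ∑ j ∈ R, ∑ j' ∈ R, (c j * d j' + c j' * d j) :=
    Finset.sum_le_sum fun j hj => Finset.sum_le_sum fun j' hj' => H j hj j' hj'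
  have l1 : ∑ j ∈ R, ∑ j' ∈ R, (a j * b j' + a j' * b j) = 2 * ((∑ j ∈ R, a j) * (∑ j ∈ R, b j)) := by
    simp only [Finset.sum_add_distrib]
    rw [Finset.sum_comm (f := fun j j' => a j' * b j), Finset.sum_mul_sum]
    ring
  have l2 : ∑ j ∈ R, ∑ j' ∈ R, (c j * d j' + c j' * d j) = 2 * ((∑ j ∈ R, c j) * (∑ j ∈ R, d j)) := by
    simp only [Finset.sum_add_distrib]
    rw [Finset.sum_comm (f := fun j j' => c j' * d j), Finset.sum_mul_sum]
    ring
  rw [l1, l2] at key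
  linarith

/-- **Bilevel ⇒ slack four-point under every positive count weight**: `μ_h(X)·Z_h = Σ_j h(j)·P_w(X ∩ L_j)` for each of the four events
(`crMeasure_real_mul_eq_sum_levels`), and the level-pair inequalities, weighted by `h(j)h(j') ≥ 0`, sum to `x₆x₇·Z² ≤ g₃g₄·Z²`.
[cite: KozmaNitzan2024, Thm. 1 (p. 7)] [cite: Grimmett2006, §1.4 eq. (1.20) (p. 15)] -/
theorem slackFourPointUnder_crMeasure_of_bilevel (hB : SlackFourPointBilevelOn V) (w : Sym2 V → unitInterval) {h : ℕ → ℝ}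
    (hpos : ∀ k, 0 < h k) (o a c b : V) : SlackFourPointUnder (crMeasure w h) o a c b := by
  unfold SlackFourPointUnder
  have hZ := crPartition_pos w hpos
  set Z := crPartition w h
  set μ := crMeasure w h
  set X₆ : Set (BondConfig V) := openConn o a ∩ openConn b c ∩ sepEv a c
  set X₇ : Set (BondConfig V) := openConn o c ∩ openConn b a ∩ sepEv a c
  set G₃ : Set (BondConfig V) := (openConn c b)ᶜ \ glueDefect o a c b
  set G₄ : Set (BondConfig V) := (openConn a b)ᶜ \ glueDefect o a c b
  rw [← mul_le_mul_iff_of_pos_right (mul_pos hZ hZ)]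
  have e : ∀ X Y : Set (BondConfig V), μ.real X * μ.real Y * (Z * Z) = (μ.real X * Z) * (μ.real Y * Z) := fun X Y => by ring
  rw [e, e, crMeasure_real_mul_eq_sum_levels w hpos X₆, crMeasure_real_mul_eq_sum_levels w hpos X₇,
    crMeasure_real_mul_eq_sum_levels w hpos G₃, crMeasure_real_mul_eq_sum_levels w hpos G₄]
  refine sum_mul_sum_le_of_symm fun j _ j' _ => ?_
  have hjj : 0 ≤ h j * h j' := mul_nonneg (hpos j).le (hpos j').le
  have key := mul_le_mul_of_nonneg_left (hB w o a c b j j') hjj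
  have lhs : h j * (prodBernoulli w).real (X₆ ∩ levelSet V j) * (h j' * (prodBernoulli w).real (X₇ ∩ levelSet V j')) +
      h j' * (prodBernoulli w).real (X₆ ∩ levelSet V j') * (h j * (prodBernoulli w).real (X₇ ∩ levelSet V j)) =
      h j * h j' * ((prodBernoulli w).real (X₆ ∩ levelSet V j) * (prodBernoulli w).real (X₇ ∩ levelSet V j') +
        (prodBernoulli w).real (X₆ ∩ levelSet V j') * (prodBernoulli w).real (X₇ ∩ levelSet V j)) := by ring
  have rhs : h j * (prodBernoulli w).real (G₃ ∩ levelSet V j) * (h j' * (prodBernoulli w).real (G₄ ∩ levelSet V j')) +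
      h j' * (prodBernoulli w).real (G₃ ∩ levelSet V j') * (h j * (prodBernoulli w).real (G₄ ∩ levelSet V j)) =
      h j * h j' * ((prodBernoulli w).real (G₃ ∩ levelSet V j) * (prodBernoulli w).real (G₄ ∩ levelSet V j') +
        (prodBernoulli w).real (G₃ ∩ levelSet V j') * (prodBernoulli w).real (G₄ ∩ levelSet V j)) := by ring
  rw [lhs, rhs]
  exact key

/-- **`SlackFourPointBilevelPos → SlackFourPointCountPos`**: the level-pair statement about Bernoulli percolation gives the slack
four-point inequality — hence additive gluing for `|A| ≤ 2` — under every positive cluster-count reweighting (every `φ_{w,q}` included).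
[cite: KozmaNitzan2024, Conj. 1 (p. 3); Thm. 1 (p. 7)] [cite: Grimmett2006, §3.9 (pp. 63–65)] -/
theorem slackFourPointCountPos_of_bilevelPos (hB : SlackFourPointBilevelPos) : SlackFourPointCountPos :=
  fun n w _ hpos o a c b => slackFourPointUnder_crMeasure_of_bilevel (hB n) w hpos o a c b

/-- **`SlackFourPointBilevelPos → AdditiveGluingTwoFKPos`** (all `q > 0`). [cite: KozmaNitzan2024, Conj. 1 (p. 3)] -/
theorem additiveGluingTwoFKPos_of_bilevelPos (hB : SlackFourPointBilevelPos) : AdditiveGluingTwoFKPos :=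
  additiveGluingTwoFKPos_of_slackFourPointFKPos (slackFourPointFKPos_of_countPos (slackFourPointCountPos_of_bilevelPos hB))

end Bilevel

end FK

end Summit.CriticalPhenomena.PercolationContinuityZ3.Theorems

end
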